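import Summits.CriticalPhenomena.CardyFormulaZ2.Theorems.CardyComplexConeEdgePrecompactUFRSCollarDecayRect
import Summits.CriticalPhenomena.CardyFormulaZ2.Theorems.CardyComplexConeEdgePrecompactUFRSStrandsArms
import Literature.Probability.Percolation.Z2HalfPlaneThreeArm

/-!
# Loose (undocked) half-plane arm events: the target format of the flat three-strand decay HT
(line `qkz-strip-boundary-arm` of crux `CardyComplexCone.EdgePrecompact`, stmt-CriticalPhenomena-11387;
vocabulary of the decomposition of the registered bridge `ufrs_rect_flatThreeStrandDecay` (HT),
worker of lead c5; see the module docstring of `…UFRSFlatThreeStrandDecayOfArms.lean` for the plan)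

The bridge HT bounds the probability of three corner-disjoint strand-crossings of the annulus
`A(z; s, S)` at a flat side / convex corner of a rectangle by `C (s/S)^{1+α}`. Its proof splits
into a deterministic half (strands of the two completed configurations give three GENUINE arms
of `ω` in the half-plane frame of the nearby side, registered sub-goal `ufrs_rect_strandsHpArms`)
and a probabilistic half (an undocked version of the half-plane three-arm bound of
Lawler–Schramm–Werner, registered sub-goal `hpLooseArms_three_decay`). This file fixes the
meeting point of the two halves:

* `hpLooseArms j k m R` — **`k` loose arms of the upper half-plane from the window box**: `k`
  lattice walks, each either an OPEN arm (a walk of `ω`-open edges through the sites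
  `siteBox j R = [j-R, j+R] × [0, R]`) or a DUAL arm (a walk of faces of
  `faceBox j R = [j-R, j+R] × [-1, R]` each of whose steps crosses an `ω`-closed edge), started
  anywhere in the window box `[j-m, j+m] × [·, m]` and ended at sup-distance `≥ R` from `(j, 0)`
  (`Z2HalfPlane.Far`), not all of the same colour, two open arms edge-disjoint, two dual arms
  crossing disjoint sets of edges. This is the tree's docked event `Z2HalfPlane.threeArm`
  (`Literature/Probability/Percolation/Z2HalfPlaneThreeArm.lean`) with the docking (open leg under
  the first site, start in the moat) REMOVED — the "`C_r` to `C_R`" form of LSW02, App. A — in the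
  colour-symmetric format of `ufrsArms` (`…UFRSEvents.lean`);
* `real_preimage_relabel_hpLooseArms` — the probability of the loose arm event in ANY lattice
  frame (automorphism `φ` of `ℤ²`: the eight point symmetries composed with translations) equals
  that of the upright one (`bondPercolation_real_preimage_relabel_iso`);
* `real_relabel_threeArm_le` — **the port of `Z2HalfPlane.real_threeArm_le` to frames**: the
  docked half-plane three-arm window bound `C (m/n)^{1+α}` holds verbatim in every lattice frame.

References: G. F. Lawler, O. Schramm, W. Werner, Electron. J. Probab. 7 (2002), Appendix A
(Lemma A.1 and the display after it: "the probability that `C_r` and `C_R` are connected in the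
half-plane by two open crossings and one closed crossing is at most `c (r/R)^{1+ε}`");
P. Nolin, Electron. J. Probab. 13 (2008), §4.6 (arm events in the half-plane); G. Grimmett,
*Percolation* (1999), §1.6 (invariance of `P_p` under lattice symmetries).
-/

namespace Summit.CriticalPhenomena.CardyFormulaZ2.Cruxes.EdgePrecompact.QkzStripBoundaryArm

open MeasureTheory Filter Set Metric
open scoped Topology BigOperators Pointwise
open Literature.Probability.LatticeModels Literature.Probability.Percolation
open Literature.Probability.RandomPlanarGeometry (DobrushinDomain)
open Summit.CriticalPhenomena.CardyFormulaZ2.Theses.CardyComplexCone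

noncomputable section

/-! ## The loose arm event -/

/-- **`k` loose (undocked) arms of the upper half-plane from the window box of half-width `m`
around `(j, 0)` to sup-distance `R`**: colours `κ` (open = `true`, dual = `false`), walks `W a`
from `x a` (in the window box: `|x a 0 - j| ≤ m`, height `≤ m`) to `y a` (`Far R j`), open arms
through `siteBox j R` along `ω`-open edges, dual arms through `faceBox j R` crossing `ω`-closed
edges (`sepEdge`), not all of one colour, open arms pairwise edge-disjoint, dual arms pairwise
crossing disjoint edge sets. -/
def hpLooseArms (j : ℤ) (k m R : ℕ) : Set (BondConfig (Site 2)) :=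
  {ω | ∃ (κ : Fin k → Bool) (x y : Fin k → Site 2) (W : ∀ a, (zdGraph 2).Walk (x a) (y a)),
    (∃ a b, κ a ≠ κ b) ∧
    (∀ a, (j - m ≤ x a 0 ∧ x a 0 ≤ j + m ∧ x a 1 ≤ m) ∧ Z2HalfPlane.Far R j (y a) ∧
      (κ a = true → (∀ u ∈ (W a).support, u ∈ Z2HalfPlane.siteBox j R) ∧ ∀ e ∈ (W a).edges, e ∈ ω) ∧
      (κ a = false → (∀ u ∈ (W a).support, u ∈ Z2HalfPlane.faceBox j R) ∧
        ∀ d ∈ (W a).darts, sepEdge d.fst d.snd ∉ ω)) ∧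
    Pairwise (fun a b => κ a = κ b → (κ a = true → ∀ e ∈ (W a).edges, e ∉ (W b).edges) ∧
      (κ a = false → ∀ d ∈ (W a).darts, ∀ d' ∈ (W b).darts, sepEdge d.fst d.snd ≠ sepEdge d'.fst d'.snd))}

/-- Membership in `hpLooseArms`, unfolded (registered sub-goal `mem_hpLooseArms_iff`; by `Iff.rfl`). -/
theorem mem_hpLooseArms_iff : ∀ (j : ℤ) (k m R : ℕ) (ω : BondConfig (Site 2)), ω ∈ hpLooseArms j k m R ↔ ∃ (κ : Fin k → Bool) (x y : Fin k → Site 2) (W : ∀ a, (zdGraph 2).Walk (x a) (y a)), (∃ a b, κ a ≠ κ b) ∧ (∀ a, (j - m ≤ x a 0 ∧ x a 0 ≤ j + m ∧ x a 1 ≤ m) ∧ Z2HalfPlane.Far R j (y a) ∧ (κ a = true → (∀ u ∈ (W a).support, u ∈ Z2HalfPlane.siteBox j R) ∧ ∀ e ∈ (W a).edges, e ∈ ω) ∧ (κ a = false → (∀ u ∈ (W a).support, u ∈ Z2HalfPlane.faceBox j R) ∧ ∀ d ∈ (W a).darts, sepEdge d.fst d.snd ∉ ω)) ∧ Pairwise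 (fun a b => κ a = κ b → (κ a = true → ∀ e ∈ (W a).edges, e ∉ (W b).edges) ∧ (κ a = false → ∀ d ∈ (W a).darts, ∀ d' ∈ (W b).darts, sepEdge d.fst d.snd ≠ sepEdge d'.fst d'.snd)) :=
  fun _ _ _ _ _ => Iff.rfl

/-! ## Lattice frames: invariance and the port of the docked bound -/

/-- **Frame invariance of the loose arm event**: for every automorphism `φ` of the square
lattice (point symmetry composed with a translation), the configurations whose `φ`-relabelling
has `k` loose arms have the same probability as the loose arm event itself
(`bondPercolation_real_preimage_relabel_iso`). -/
theorem real_preimage_relabel_hpLooseArms (φ : zdGraph 2 ≃g zdGraph 2) (j : ℤ) (k m R : ℕ) :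
    (bondPercolation (zdGraph 2) half).real (BondConfig.relabel (sym2Equiv φ.toEquiv) ⁻¹' hpLooseArms j k m R) =
      (bondPercolation (zdGraph 2) half).real (hpLooseArms j k m R) :=
  bondPercolation_real_preimage_relabel_iso φ half _

/-- **The docked half-plane three-arm window bound in every lattice frame** (port of
`Z2HalfPlane.real_threeArm_le`): there are `C`, `α > 0` and `K ≥ 1` such that for every
automorphism `φ` of `ℤ²`, every window `[j, j+m)` and all `1 ≤ m ≤ n`, `K n ≤ R`, the
configurations whose `φ`-relabelling lies in `Z2HalfPlane.threeArm j m R` have probability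
`≤ C (m/n)^{1+α}`. -/
theorem real_relabel_threeArm_le : ∃ C α : ℝ, 0 < C ∧ 0 < α ∧ ∃ K : ℕ, 1 ≤ K ∧
    ∀ (φ : zdGraph 2 ≃g zdGraph 2) (j : ℤ) (m n R : ℕ), 1 ≤ m → m ≤ n → K * n ≤ R →
      (bondPercolation (zdGraph 2) half).real
          (BondConfig.relabel (sym2Equiv φ.toEquiv) ⁻¹' Z2HalfPlane.threeArm j m R) ≤
        C * ((m : ℝ) / n) ^ (1 + α) := by
  obtain ⟨C, α, hC, hα, K, hK, h⟩ := Z2HalfPlane.real_threeArm_le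
  refine ⟨C, α, hC, hα, K, hK, fun φ j m n R hm hmn hR => ?_⟩
  rw [bondPercolation_real_preimage_relabel_iso φ half]
  exact h j m n R hm hmn hR

/-! ## Elementary properties -/

/-- The loose arm event only grows when the window box grows. -/
theorem hpLooseArms_mono_window {j : ℤ} {k m m' R : ℕ} (h : m ≤ m') :
    hpLooseArms j k m R ⊆ hpLooseArms j k m' R := by
  rintro ω ⟨κ, x, y, W, hne, harm, hpw⟩
  refine ⟨κ, x, y, W, hne, fun a => ⟨?_, (harm a).2⟩, hpw⟩
  obtain ⟨⟨h1, h2, h3⟩, -⟩ := harm a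
  have : (m : ℤ) ≤ m' := by exact_mod_cast h
  exact ⟨by omega, by omega, by omega⟩

/-- With fewer than two arms the loose arm event is empty (two colours are required). -/
theorem hpLooseArms_eq_empty_of_lt_two {j : ℤ} {k m R : ℕ} (hk : k < 2) : hpLooseArms j k m R = ∅ := by
  ext ω
  simp only [Set.mem_empty_iff_false, iff_false]
  rintro ⟨κ, x, y, W, ⟨a, b, hab⟩, -, -⟩
  have : a = b := by
    have ha := a.2; have hb := b.2
    exact Fin.ext (by omega)
  exact hab (this ▸ rfl)

end

end Summit.CriticalPhenomena.CardyFormulaZ2.Cruxes.EdgePrecompact.QkzStripBoundaryArm
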